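import Summits.KontsevichZagierPeriods.Zeta5Search.LaiSweepShard

/-!
# `κ₃` sweep certificate — shard file 033 of 127 (shards 231–237 of 889)

HONEST FRAMING. Systematic search; no irrationality claim unless certified. This file only checks,
by `decide +kernel`, shards 231–237 of the order-cell sweep of the `κ₃` point `(74, 2180, 444; δ74)`
(engine `LaiSweepEngine`, soundness `LaiSweepJump/Free/Eval/Shard/Kappa3`; a shard is `⟨regime, n,
p, q, p', q', Lo, Up⟩`: `n` cells from `p/q` to `p'/q'` with integer rate sums in `[Lo, Up]`, `K =
128`, `D = 2^40`). It draws NO conclusion: only the capstone `LaiKappa3SweepCert`, which needs all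
127 shard files, does. Kernel cost of this file ≈ 560 cells × 0.3 s.
-/

namespace Summit.KontsevichZagierPeriods.Zeta5Search.Sweep

set_option maxHeartbeats 100000000 in
/-- Shard 231: 80 cells of regime B from `64/371` to `37/213`.
[cite: Lai2024BallRivoal, §4 Lemma 4.3] -/
theorem shard231 :
    Shard.check 128 (2^40)
      ⟨true, 80, 64, 371, 37, 213, 36000466052772, 36730768637954⟩ = true := by
  decide +kernel

set_option maxHeartbeats 100000000 in
/-- Shard 232: 80 cells of regime B from `37/213` to `7/40`.
[cite: Lai2024BallRivoal, §4 Lemma 4.3] -/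
theorem shard232 :
    Shard.check 128 (2^40)
      ⟨true, 80, 37, 213, 7, 40, 38284944985733, 39077111472595⟩ = true := by
  decide +kernel

set_option maxHeartbeats 100000000 in
/-- Shard 233: 80 cells of regime B from `7/40` to `40/227`.
[cite: Lai2024BallRivoal, §4 Lemma 4.3] -/
theorem shard233 :
    Shard.check 128 (2^40)
      ⟨true, 80, 7, 40, 40, 227, 35810523229202, 36561459574872⟩ = true := by
  decide +kernel

set_option maxHeartbeats 100000000 in
/-- Shard 234: 80 cells of regime B from `40/227` to `49/276`.
[cite: Lai2024BallRivoal, §4 Lemma 4.3] -/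
theorem shard234 :
    Shard.check 128 (2^40)
      ⟨true, 80, 40, 227, 49, 276, 38769699723674, 39599525304412⟩ = true := by
  decide +kernel

set_option maxHeartbeats 100000000 in
/-- Shard 235: 80 cells of regime B from `49/276` to `32/179`.
[cite: Lai2024BallRivoal, §4 Lemma 4.3] -/
theorem shard235 :
    Shard.check 128 (2^40)
      ⟨true, 80, 49, 276, 32, 179, 35982533131186, 36763342860850⟩ = true := by
  decide +kernel

set_option maxHeartbeats 100000000 in
/-- Shard 236: 80 cells of regime B from `32/179` to `74/411`.
[cite: Lai2024BallRivoal, §4 Lemma 4.3] -/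
theorem shard236 :
    Shard.check 128 (2^40)
      ⟨true, 80, 32, 179, 74, 411, 36943555966147, 37758085173461⟩ = true := by
  decide +kernel

set_option maxHeartbeats 100000000 in
/-- Shard 237: 80 cells of regime B from `74/411` to `56/309`.
[cite: Lai2024BallRivoal, §4 Lemma 4.3] -/
theorem shard237 :
    Shard.check 128 (2^40)
      ⟨true, 80, 74, 411, 56, 309, 33895134609149, 34653513916128⟩ = true := by
  decide +kernel

/-- The checked shards of this file, in order. [folklore] -/
def shards033 : List (CheckedShard 128 (2^40)) :=
  [⟨_, shard231⟩, ⟨_, shard232⟩, ⟨_, shard233⟩, ⟨_, shard234⟩, ⟨_, shard235⟩,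
    ⟨_, shard236⟩, ⟨_, shard237⟩]

end Summit.KontsevichZagierPeriods.Zeta5Search.Sweep
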